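import Literature.Geometry.Riemannian.GromovW1CommonSpace
import Literature.Geometry.Riemannian.VarianceLowerSemicontinuous
import Literature.Geometry.Riemannian.MassDistributionLimit
import HarnessLib

/-!
# The spaces `𝕄_r(V, b)` and their closedness in `d_{GW₁}` (Bamler 2023, §2.5, Definition and
# Lemma)

R. Bamler, *Compactness theory of the space of super Ricci flows*, Invent. Math. 233 (2023), §2.5,
Definition: *"For any `r, V > 0` and any function `b : (0, 1] → (0, 1]`, let `𝕄_r(V, b) ⊂ 𝕄` be the
set of isometry classes of metric measure spaces `(X, d, μ)` of full support that satisfy: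
(1) `Var(μ) ≤ V r²`. (2) `b^{(X,d,μ)}_r ≥ b`"*, and the Lemma: *"`𝕄_r(V, b)` is closed in
`(𝕄, d_{GW₁})`"*, whose printed proof reduces, through isometric embeddings
`φᵢ : Xᵢ → Z` (`i = 1, …, ∞`) into one complete separable `Z` with `(φᵢ)_* μᵢ → (φ_∞)_* μ_∞` in `W₁`
(`GromovW1CommonSpace.lean`), to the Lemma on `W₁`-limits: (a) `Var` is lower semicontinuous
(`VarianceLowerSemicontinuous.lean`), (b) `b^{(X,d,μ)}_r(ε)` is upper semicontinuous
(`MassDistributionLimit.lean`). Both defining quantities are invariant under isometric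
embeddings, so we state membership as a predicate on `(X, μ)`:

* `IsMVb μ r V b` — **`(X, d, μ)` represents a class of `𝕄_r(V, b)`**;
* `variance_map_isometry`, `measure_thinSet_map_isometry`, `massDistribution_map_isometry` —
  invariance under isometric embeddings;
* `IsMVb.of_tendsto_gromovW1` — **`𝕄_r(V, b)` is closed under `d_{GW₁}`-limits**.

Everything is proved; the only definition is the predicate; no named facts.

## References

* R. H. Bamler, *Compactness theory of the space of super Ricci flows*, Invent. Math. 233 (2023),
  §2.5, Definition (`𝕄_r(V, b)`) and Lemma (`𝕄_r(V, b)` is closed). [Bamler2023]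
-/

noncomputable section

open Set MeasureTheory Filter Topology Metric
open scoped ENNReal NNReal

namespace Literature.Geometry.Riemannian

universe u

/-! ### Invariance under isometric embeddings -/

section Invariance

variable {X Z : Type*} [MetricSpace X] [MeasurableSpace X] [BorelSpace X]
  [MetricSpace Z] [MeasurableSpace Z] [BorelSpace Z]

/-- `Var(φ_* μ) = Var(μ)` for an isometric embedding `φ`. [folklore] -/
theorem variance_map_isometry [SecondCountableTopology X] [SecondCountableTopology Z] {φ : X → Z}
    (hφ : Isometry φ) (μ : Measure X) [SFinite μ] :
    variance (μ.map φ) (μ.map φ) = variance μ μ := by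
  have hm : Measurable φ := hφ.continuous.measurable
  haveI : SFinite (μ.map φ) := inferInstance
  have hin : ∀ z : Z, ∫⁻ z', edist z z' ^ 2 ∂(μ.map φ) = ∫⁻ x', edist z (φ x') ^ 2 ∂μ := fun z ↦
    lintegral_map ((measurable_const.edist measurable_id).pow_const 2) hm
  have hF : Measurable fun z : Z ↦ ∫⁻ x', edist z (φ x') ^ 2 ∂μ :=
    (((continuous_fst.edist (hφ.continuous.comp continuous_snd)).measurable).pow_const 2)
      |>.lintegral_prod_right'
  rw [variance_def, variance_def]
  simp_rw [hin]
  rw [lintegral_map hF hm]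
  refine lintegral_congr fun x ↦ lintegral_congr fun x' ↦ ?_
  rw [hφ.edist_eq]

/-- `(φ_* μ)(D(φ x, ρ)) = μ(D(x, ρ))` for an isometric embedding `φ`. [folklore] -/
theorem measure_closedBall_map_isometry {φ : X → Z} (hφ : Isometry φ) (μ : Measure X) (x : X)
    (ρ : ℝ) : (μ.map φ) (closedBall (φ x) ρ) = μ (closedBall x ρ) := by
  rw [Measure.map_apply hφ.continuous.measurable measurableSet_closedBall, hφ.preimage_closedBall]

/-- `(φ_* μ)({z : (φ_* μ)(D(z, ρ)) < δ}) = μ({x : μ(D(x, ρ)) < δ})` for an isometric embedding `φ`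
and a finite measure `μ`. [folklore] -/
theorem measure_thinSet_map_isometry {φ : X → Z} (hφ : Isometry φ) (μ : Measure X)
    [IsFiniteMeasure μ] (ρ : ℝ) (δ : ℝ≥0∞) :
    (μ.map φ) (thinSet (μ.map φ) ρ δ) = μ (thinSet μ ρ δ) := by
  haveI : IsFiniteMeasure (μ.map φ) := Measure.isFiniteMeasure_map _ _
  rw [Measure.map_apply hφ.continuous.measurable (isOpen_thinSet _ _ _).measurableSet]
  congr 1
  ext x
  simp only [mem_preimage, mem_thinSet, measure_closedBall_map_isometry hφ]

/-- `b^{(Z,d,φ_* μ)}_r(ε) = b^{(X,d,μ)}_r(ε)` for an isometric embedding `φ` and a finite measure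
`μ` (the thin sets correspond and have the same mass).
[cite: Bamler2023, §2.5, Definition (mass distribution function)] -/
theorem massDistribution_map_isometry {φ : X → Z} (hφ : Isometry φ) (μ : Measure X)
    [IsFiniteMeasure μ] (r ε : ℝ) : massDistribution (μ.map φ) r ε = massDistribution μ r ε := by
  unfold massDistribution
  simp_rw [measure_thinSet_map_isometry hφ]

end Invariance

/-! ### `𝕄_r(V, b)` and its closedness -/

/-- **`(X, d, μ)` represents a class in `𝕄_r(V, b)`** (Bamler 2023, §2.5, Definition):
`Var(μ) ≤ V r²` and `b^{(X,d,μ)}_r ≥ b` on `(0, 1]` (both quantities depend only on the class of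
`(X, d, μ)` in `𝕄`). [cite: Bamler2023, §2.5, Definition (𝕄_r(V, b))] -/
def IsMVb {X : Type*} [MetricSpace X] [MeasurableSpace X] (μ : Measure X) (r V : ℝ)
    (b : ℝ → ℝ≥0∞) : Prop :=
  variance μ μ ≤ ENNReal.ofReal (V * r ^ 2) ∧ ∀ ε ∈ Ioc (0 : ℝ) 1, b ε ≤ massDistribution μ r ε

/-- **`𝕄_r(V, b)` is closed in `(𝕄, d_{GW₁})`** (Bamler 2023, §2.5, Lemma): if
`(Xᵢ, dᵢ, μᵢ) ∈ 𝕄_r(V, b)` (probability measures on complete separable metric spaces) and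
`d_{GW₁}((Xᵢ, μᵢ), (X_∞, μ_∞)) → 0`, then `(X_∞, μ_∞) ∈ 𝕄_r(V, b)` (`b ≤ 1`). Printed proof:
common embeddings with `W₁`-convergence (`exists_common_polish_of_tendsto_gromovW1`), then (a), (b)
of the Lemma on `W₁`-limits, transported by isometry invariance.
[cite: Bamler2023, §2.5, Lemma (𝕄_r(V, b) is closed)] -/
theorem IsMVb.of_tendsto_gromovW1 {X : ℕ → Type u} [∀ i, MetricSpace (X i)]
    [∀ i, MeasurableSpace (X i)] [∀ i, BorelSpace (X i)] [∀ i, SecondCountableTopology (X i)]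
    [∀ i, CompleteSpace (X i)] {μ : ∀ i, Measure (X i)} [∀ i, IsProbabilityMeasure (μ i)]
    {X' : Type u} [MetricSpace X'] [MeasurableSpace X'] [BorelSpace X'] [SecondCountableTopology X']
    [CompleteSpace X'] {μ' : Measure X'} [IsProbabilityMeasure μ']
    (hlim : Tendsto (fun i ↦ gromovW1 (μ i) μ') atTop (𝓝 0)) {r V : ℝ} {b : ℝ → ℝ≥0∞}
    (hb1 : ∀ ε, b ε ≤ 1) (h : ∀ i, IsMVb (μ i) r V b) : IsMVb μ' r V b := by
  obtain ⟨S, _, _, _, _, _, e, e', he, he', hW⟩ :=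
    exists_common_polish_of_tendsto_gromovW1 μ μ' hlim
  -- the push-forwards as probability measures on `S`
  haveI : ∀ i, IsProbabilityMeasure ((μ i).map (e i)) := fun i ↦
    Measure.isProbabilityMeasure_map (he i).continuous.measurable.aemeasurable
  haveI : IsProbabilityMeasure (μ'.map e') :=
    Measure.isProbabilityMeasure_map he'.continuous.measurable.aemeasurable
  set P : ℕ → ProbabilityMeasure S := fun i ↦ ⟨(μ i).map (e i), inferInstance⟩ with hP
  set P' : ProbabilityMeasure S := ⟨μ'.map e', inferInstance⟩ with hP'
  have hW' : Tendsto (fun i ↦ wassersteinW1 (P i : Measure S) (P' : Measure S)) atTop (𝓝 0) := hW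
  constructor
  · -- (a) `Var` is lower semicontinuous
    have hlsc := variance_le_liminf_of_tendsto_wassersteinW1 hW'
    have hle : liminf (fun i ↦ variance (P i : Measure S) (P i : Measure S)) atTop ≤
        ENNReal.ofReal (V * r ^ 2) := by
      refine liminf_le_of_frequently_le' (Eventually.frequently (Eventually.of_forall fun i ↦ ?_))
      show variance ((μ i).map (e i)) ((μ i).map (e i)) ≤ ENNReal.ofReal (V * r ^ 2)
      rw [variance_map_isometry (he i)]
      exact (h i).1
    have hV : variance (P' : Measure S) (P' : Measure S) = variance μ' μ' := variance_map_isometry he' μ'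
    rw [← hV]
    exact hlsc.trans hle
  · -- (b) the mass distribution is upper semicontinuous
    intro ε hε
    have hb := le_massDistribution_of_tendsto (μs := P) (μ := P') hW' (r := r) (ε := ε) (hb1 ε)
      fun i ↦ by
        show b ε ≤ massDistribution ((μ i).map (e i)) r ε
        rw [massDistribution_map_isometry (he i)]
        exact (h i).2 ε hε
    have hm : massDistribution (P' : Measure S) r ε = massDistribution μ' r ε :=
      massDistribution_map_isometry he' μ' r ε
    rwa [hm] at hb

end Literature.Geometry.Riemannian

end
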